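import Literature.NumberTheory.EllipticCurves.Tian2014.CMPointSystemOneModFour
import Literature.NumberTheory.EllipticCurves.Tian2014.CMPointSystemDescentPrimeBase
import Literature.NumberTheory.EllipticCurves.Tian2014.ClassFiveFamilyDescentProofs
import Literature.NumberTheory.EllipticCurves.TianYuanZhang2017.ScriptLOddOfRhoZero
import Literature.NumberTheory.QuadraticFields.RedeiReichardtFourRank
import Literature.NumberTheory.QuadraticFields.RedeiReichardtParametrisation
import HarnessLib

/-!
# Tian 2014 Prop. 4.2 (= Monsky 1990 Thm. 3.6, the `p₅` case) transplanted onto the `n ≡ 1 (mod 4)` CM-point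
# system: for `n = p₀ ≡ 5 (mod 8)` prime, `2y_{p₀} ∈ E(ℚ(√p₀))⁻ ∖ (2E(ℚ(√p₀))⁻ + E[2])` — the last one-prime
# family of Cor. 5.15 (1), from the printed system plus two printed sentences of §4.1 as binders

Cell `bsd-monsky` (prover-A seat, g14; `run/shared/lean/pub/bsd-monsky/`). HONEST FRAMING (README §1): nothing is
asserted about BSD, nothing is booked, no `_holds`, no named fact; this file PROVES theorems on the data
`D : CMPointDataOne n` of `CMPointSystemOneModFour.lean` (Tian's system `(H, 𝒜, σ_t, conj, z_t)` for `n ≡ 1 (mod 4)`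
with its printed properties as hypotheses) and pure algebra. NOTHING NEW ON PAPER: Tian proves Prop. 4.2 in print
("When `k = 0` the above theorem is due to Monsky [19]"); with g13's `p₇`, `2p₇`, `2p₃` (the `n ≡ 3 (mod 4)` system)
this completes Monsky's Cor. 5.15 (1) «`p₅, p₇, 2p₇ and 2p₃`» for Tian's points — the `k = 0` base cases of BOTH of
Tian's inductions (Thm. 4.1 for `p₀ ≡ 5`, Thms. 4.4–4.5 for `p₀ ≡ 3 (mod 4)`).

## Source (verbatim, arXiv:1210.8231)

* Prop. 4.2 (p0019 L74–L81): "Let `n = p₀ ≡ 5 mod 8` be a prime. Then the point `y_{p₀}` satisfies: `y_{p₀} ∈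
  E(ℚ(√p₀)) ∖ E(ℚ(√p₀))⁻` and `2y_{p₀} ∈ E(ℚ(√p₀))⁻ ∖ (2E(ℚ(√p₀))⁻ + E[2])`. In particular, `2y_{p₀} ∈ E(ℚ(√p₀))⁻`
  is of infinite order and therefore `p₀` is a congruent number."
* Proof (p0020 L1–L22): "In this case `K(√p₀) = H₀` and the ideal class group `𝒜` of `K = ℚ(√−2p₀)` satisfies that
  `2𝒜 ≅ Gal(H/H₀)` has odd cardinality. Note that the action of the complex conjugation on `Gal(H/K)` is given by
  inverse and `Gal(H/K(√p₀))` is stable under this action. It follows that the point `y_{p₀} = Tr_{H/K(√p₀)} z` is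
  fixed by the action of complex conjugation and therefore `y_{p₀} ∈ E(ℚ(√p₀))`. For any `t ∈ K̂ˣ`, we have that
  `z_{ϖt} + z_t = (0, 0)` by Theorem 2.4 (3). Thus `y_{p₀} + y_{p₀}^{σ_ϖ} = #Gal(H/K(√p₀))·(0, 0) = #2𝒜·(0, 0) =
  (0, 0)`. Since `σ_ϖ(√p₀) = [(2p₀)₂, ℚ^ab/ℚ](√p₀) = [2₂, ℚ^ab/ℚ](√p₀) = (2/p₀)√p₀ = −√p₀`, `σ_ϖ` acts on `K(√p₀)`
  non-trivially, thus `2y_{p₀} ∈ E(ℚ(√p₀))⁻` but `y_{p₀} ∉ E(ℚ(√p₀))⁻`. Suppose that `2y_{p₀} ∈ 2E(ℚ(√p₀))⁻ + E[2]`,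
  say, `2y_{p₀} = 2y′ + t` for some `y′ ∈ E(ℚ(√p₀))⁻` and `t ∈ E[2]`. Then we have that `2(y_{p₀} − y′) = t`. Thus
  `y_{p₀} − y′ ∈ E[4] ∩ E(ℚ(√p₀)) = E[2]` and then `y_{p₀} ∈ y′ + E[2] ⊂ E(ℚ(√p₀))⁻`, a contradiction."
* §4.1 (p0019 L44–L48): "the condition (1.1) in Theorem 1.3 says that the ideal class group `𝒜` of `K = ℚ(√−2n)`
  has no order `4` elements, or equivalently that `2𝒜 ≅ Gal(H/H₀)` has odd cardinality."

## What is proved here (kernel), and from what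

* §1 finite abelian groups: when `#G = 2·#G²` the non-squares form the coset `s·G²` of any non-square `s`
  (`exists_isSquare_and_eq_mul_of_not_isSquare`); images of the set of squares under `t ↦ st` and `t ↦ t⁻¹`.
* §2 `K = ℚ(√−2p₀)`, `p₀ ≡ 5 (mod 8)`: `#𝒜[2] = 2` (Gauss, `t = 2` ramified primes — the tree's
  `RedeiReichardt.natCard_sq_eq_one_eq`) and `#(2𝒜)` ODD (Tian's (1.1) at `k = 0` — the tree's `condition11_caseFive`,
  Rédei–Reichardt a tree theorem); hence `#𝒜 = 2·#(2𝒜)` and `[ϖ] ∉ 2𝒜`. "`2𝒜` has odd cardinality" is a KERNEL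
  THEOREM, not a display.
* §3 on the data: `y₀ = Σ_{t ∈ 2𝒜} z_t` is fixed by `σ_s` (`s ∈ 2𝒜`) and by complex conjugation (Thm. 2.4 (2): `2𝒜`
  is inverse-stable), and `σ_s(y₀) = (0, 0) − y₀` for `s ∉ 2𝒜` (`s·2𝒜 = [ϖ]·2𝒜`, Thm. 2.4 (3), `#(2𝒜)` odd).
* §4 `2y₀` is the transfer along `√p₀` of a rational point of `E_{p₀}` ("`2y_{p₀} ∈ E(ℚ(√p₀))⁻`"): the automorphisms
  fixing `√p₀` and fixing `2y₀` together with those negating both form a subgroup containing `{σ_t}` and complex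
  conjugation, hence (generation sentence) all of `Gal(H/ℚ)`; Galois descent (`exists_transferEPos_eq_of_forall_gal`).
* §5 THE DESCENT (Prop. 4.2): the rational point `y″` with `transfer y″ = 2y₀` is not `2z + t` with `t` torsion — else
  `Q := y₀ − transfer z` has `4Q = 0`, so `2Q = 0` (`E(H)[4] = E[2]`: `i ∉ H`, hence `√2 ∉ H`), `Q` is rational
  `2`-torsion, and `σ_{[ϖ]}(y₀) = −transfer z + Q = −y₀ + 2Q = −y₀`, against `σ_{[ϖ]}(y₀) = (0, 0) − y₀`.
* INPUTS beyond `D.Printed`, taken as BINDERS (no new named fact): a square root `θ = √p₀ ∈ H` with "complex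
  conjugation fixes `√p₀`" (`√p₀` real) and "`2𝒜 ≅ Gal(H/H₀)`, `H₀ = K(√p₀)`" (`σ_s` fixes `√p₀` iff `s ∈ 2𝒜`;
  p0019 L46–L48, p0020 L2–L4; Gauss' genus theory), and "`i ∉ H`" (the Hilbert class field of `ℚ(√−2p₀)` does not
  contain `i`: `K(i)/K` is ramified above `2` — Tian prints the sentence for the `n ≡ 3 (mod 4)` system, p0022 L52–L56
  "`√2 ∈ H₀` but `i ∉ H`"; for `n ≡ 1 (mod 4)` it is the content of "`E[4] ∩ E(ℚ(√p₀)) = E[2]`", p0020 L19–L21).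

[cite: Tian2014, Prop. 4.2 and its proof (arXiv:1210.8231 p0019 L74–p0020 L23), §4.1 (p0019 L44–L63), Thm. 2.4 (p0008 L68–L74), Lemma 5.1 (p. 28)]
[cite: Monsky1990MockHeegner, Thm. 3.6 (p. 53), Cor. 5.15 (1) (p. 66)] [cite: Cox2013, Prop. 3.11] [cite: LiMa2008, Thm. 0.4]
[cite: SilvermanAEC2009, III.2.3]
-/

noncomputable section

open scoped Classical

open Matrix WeierstrassCurve NumberField Literature.NumberTheory.EllipticCurves
  Literature.NumberTheory.EllipticCurves.TianYuanZhang2017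
  Literature.NumberTheory.EllipticCurves.HeathBrown1994
  Literature.NumberTheory.QuadraticFields.RedeiReichardt
open Literature.NumberTheory.EllipticCurves.Monsky1990 (eq_of_two_nsmul_eq_zero map_sub_self_eq_zero_of_two_nsmul_eq_zero)

set_option autoImplicit false

namespace Literature.NumberTheory.EllipticCurves.Tian2014

/-! ## §1 Finite abelian groups: the squares as an index-`2` subgroup, and its non-trivial coset -/

section Squares

variable {G : Type*} [CommGroup G] [Fintype G]

/-- The number of elements of the finset of squares is `#G²` (`Nat.card` of the subtype).
[cite: Tian2014, §4.1 (p0019 L47–L48: 2𝒜 ≅ Gal(H/H₀))] [folklore] -/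
theorem card_filter_isSquare (G : Type*) [CommGroup G] [Fintype G] :
    (Finset.univ.filter fun t : G => IsSquare t).card = Nat.card {a : G // IsSquare a} := by
  rw [Nat.card_eq_fintype_card, Fintype.card_subtype]

/-- The set of squares is stable under multiplication by a square. [cite: Cox2013, Prop. 3.11 (the principal genus Cl²)] [folklore] -/
theorem image_mul_filter_isSquare_of_isSquare {s : G} (hs : IsSquare s) :
    (Finset.univ.filter fun t : G => IsSquare t).image (fun t => s * t) =
      Finset.univ.filter fun t : G => IsSquare t := by
  ext x
  simp only [Finset.mem_image, Finset.mem_filter, Finset.mem_univ, true_and]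
  constructor
  · rintro ⟨t, ht, rfl⟩
    exact hs.mul ht
  · intro hx
    obtain ⟨r, hr⟩ := hs
    refine ⟨s⁻¹ * x, ?_, by rw [mul_inv_cancel_left]⟩
    have : IsSquare s⁻¹ := ⟨r⁻¹, by rw [hr, mul_inv]⟩
    exact this.mul hx

/-- The set of squares is stable under inversion. [cite: Cox2013, Prop. 3.11] [folklore] -/
theorem image_inv_filter_isSquare :
    (Finset.univ.filter fun t : G => IsSquare t).image (fun t => t⁻¹) =
      Finset.univ.filter fun t : G => IsSquare t := by
  ext x
  simp only [Finset.mem_image, Finset.mem_filter, Finset.mem_univ, true_and]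
  constructor
  · rintro ⟨t, ⟨r, hr⟩, rfl⟩
    exact ⟨r⁻¹, by rw [hr, mul_inv]⟩
  · rintro ⟨r, hr⟩
    exact ⟨x⁻¹, ⟨r⁻¹, by rw [hr, mul_inv]⟩, inv_inv x⟩

/-- **When `#G = 2·#G²`, every non-square lies in the coset `s·G²` of any non-square `s`** ("`𝒜/2𝒜` has order `2`":
`𝒜 = 2𝒜 ⊔ [ϖ]·2𝒜`). Counting: `t ↦ st` maps the squares injectively into the non-squares, which are exactly as many.
[cite: Tian2014, Prop. 4.2 proof (p0020 L10–L12: y + y^{σ_ϖ} = #2𝒜·(0,0))] [cite: Cox2013, Prop. 3.11] -/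
theorem exists_isSquare_and_eq_mul_of_not_isSquare
    (hcard : Nat.card G = 2 * Nat.card {a : G // IsSquare a}) {s s' : G} (hs : ¬ IsSquare s)
    (hs' : ¬ IsSquare s') : ∃ t, IsSquare t ∧ s' = s * t := by
  set Sq : Finset G := Finset.univ.filter fun t : G => IsSquare t with hSq
  set C : Finset G := Finset.univ.filter fun t : G => ¬ IsSquare t with hC
  have hSqC : C = Sqᶜ := by
    ext x; simp [hSq, hC]
  have hcardSq : Sq.card = Nat.card {a : G // IsSquare a} := card_filter_isSquare G
  have hcardC : C.card = Sq.card := by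
    rw [hSqC, Finset.card_compl, Fintype.card_eq_nat_card, hcard, hcardSq]
    omega
  have hsub : Sq.image (fun t => s * t) ⊆ C := by
    intro x hx
    obtain ⟨t, ht, rfl⟩ := Finset.mem_image.mp hx
    rw [hC, Finset.mem_filter]
    refine ⟨Finset.mem_univ _, fun hst => hs ?_⟩
    have ht' : IsSquare t := (Finset.mem_filter.mp ht).2
    obtain ⟨r, hr⟩ := ht'
    have : IsSquare t⁻¹ := ⟨r⁻¹, by rw [hr, mul_inv]⟩
    have := hst.mul this
    rwa [mul_inv_cancel_right] at this
  have hinj : Set.InjOn (fun t => s * t) (Sq : Set G) := fun a _ b _ hab => mul_left_cancel hab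
  have heq : Sq.image (fun t => s * t) = C :=
    Finset.eq_of_subset_of_card_le hsub (by rw [Finset.card_image_of_injOn hinj, hcardC])
  have hs'C : s' ∈ C := by rw [hC, Finset.mem_filter]; exact ⟨Finset.mem_univ _, hs'⟩
  rw [← heq] at hs'C
  obtain ⟨t, ht, hst⟩ := Finset.mem_image.mp hs'C
  exact ⟨t, (Finset.mem_filter.mp ht).2, hst.symm⟩

/-- **The non-trivial coset of the squares does not depend on its representative**: for non-squares `s, s′` the
images of the squares under `t ↦ st` and `t ↦ s′t` coincide (when `#G = 2·#G²`).
[cite: Tian2014, Prop. 4.2 proof (p0020 L10–L12)] [cite: Cox2013, Prop. 3.11] -/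
theorem image_mul_filter_isSquare_eq_of_not_isSquare
    (hcard : Nat.card G = 2 * Nat.card {a : G // IsSquare a}) {s s' : G} (hs : ¬ IsSquare s)
    (hs' : ¬ IsSquare s') :
    (Finset.univ.filter fun t : G => IsSquare t).image (fun t => s' * t) =
      (Finset.univ.filter fun t : G => IsSquare t).image (fun t => s * t) := by
  obtain ⟨t₀, ht₀, rfl⟩ := exists_isSquare_and_eq_mul_of_not_isSquare hcard hs hs'
  rw [show (fun t => s * t₀ * t) = (fun t => s * t) ∘ (fun t => t₀ * t) from by
    funext t; simp [mul_assoc], ← Finset.image_image, image_mul_filter_isSquare_of_isSquare ht₀]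

omit [Fintype G] in
/-- **An element of order `2` is not a square when `#G²` is odd** (`[ϖ] ∉ 2𝒜`). [cite: Tian2014, §4.1 (p0019 L44–L48)] [folklore] -/
theorem not_isSquare_of_mul_self_eq_one_of_odd {π : G} (hπ2 : π * π = 1) (hπ1 : π ≠ 1)
    (hodd : Odd (Nat.card {a : G // IsSquare a})) : ¬ IsSquare π := by
  intro hπ
  let f : G →* G := powMonoidHom 2
  have hmem : π ∈ f.range := by
    obtain ⟨r, hr⟩ := hπ
    exact ⟨r, by rw [powMonoidHom_apply, sq, hr]⟩
  have hcard : Nat.card f.range = Nat.card {a : G // IsSquare a} := by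
    refine Nat.card_congr (Equiv.subtypeEquivRight fun a => ?_)
    rw [MonoidHom.mem_range]
    constructor
    · rintro ⟨y, hy⟩
      exact ⟨y, by rw [← hy, powMonoidHom_apply, sq]⟩
    · rintro ⟨r, hr⟩
      exact ⟨r, by rw [powMonoidHom_apply, sq, hr]⟩
  haveI : Fact (Nat.Prime 2) := ⟨Nat.prime_two⟩
  have hord : orderOf (⟨π, hmem⟩ : f.range) = 2 := by
    apply orderOf_eq_prime
    · ext; simp [sq, hπ2]
    · intro h
      apply hπ1
      have := congrArg Subtype.val h
      simpa using this
  have hdvd : orderOf (⟨π, hmem⟩ : f.range) ∣ Nat.card f.range := orderOf_dvd_natCard _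
  rw [hord, hcard] at hdvd
  exact (Nat.not_even_iff_odd.mpr hodd) (even_iff_two_dvd.mpr hdvd)

end Squares

/-! ## §2 `K = ℚ(√−2p)`, `p ≡ 5 (mod 8)`: `#𝒜[2] = 2` (Gauss) and `#(2𝒜)` odd (Tian's (1.1) at `k = 0`) -/

/-- **`#𝒜[2] = 2` for `K = ℚ(√−2p)`, `p ≡ 5 (mod 8)` prime**: Gauss' count `#𝒜[2] = 2^{t−1}` with `t = 2` ramified
primes (`2` and `p`; the tree's `RedeiReichardt.natCard_sq_eq_one_eq`). [cite: Cox2013, Prop. 3.11] [cite: Tian2014, Lemma 5.1 proof (p. 28)] -/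
theorem natCard_sq_eq_one_classGroup_genusField_two_mul_five_mod_eight {p : ℕ} (hp : p.Prime) (hp8 : p % 8 = 5) :
    Nat.card {c : ClassGroup (𝓞 (GenusField (2 * p))) // c ^ 2 = 1} = 2 := by
  have hp2 : p ≠ 2 := by rintro rfl; norm_num at hp8
  have hd1 : 1 ≤ 2 * p := by have := hp.two_le; omega
  obtain ⟨x, -, hx⟩ := exists_ringOfIntegers_sq_eq_neg (K := GenusField (2 * p)) (root_genusField_sq hd1)
  have hq : ∀ i, ((![2, p] : Fin 2 → ℕ) i).Prime := by
    intro i; fin_cases i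
    · exact Nat.prime_two
    · exact hp
  have hinj : Function.Injective (![2, p] : Fin 2 → ℕ) := by
    intro i j hij
    fin_cases i <;> fin_cases j <;> simp_all
  have hprod : ∏ i, (![2, p] : Fin 2 → ℕ) i = if (2 * p) % 4 = 1 then 2 * (2 * p) else 2 * p := by
    rw [if_neg (by omega), Fin.prod_univ_two]; rfl
  have := natCard_sq_eq_one_eq (finrank_genusField (2 * p)) hx hq hinj hprod
  simpa using this

/-- **`#(2𝒜)` is ODD for `K = ℚ(√−2p)`, `p ≡ 5 (mod 8)` prime** — Tian's condition (1.1) at `k = 0` ("`𝒜` has no order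
`4` elements, or equivalently `2𝒜 ≅ Gal(H/H₀)` has odd cardinality", §4.1): the tree's `condition11_caseFive`
(Lemma 5.1 ⇐, Rédei–Reichardt a tree theorem) gives `#(2𝒜 ∩ 𝒜[2]) = 1`, i.e. `#(2𝒜)` odd.
[cite: Tian2014, §4.1 (p0019 L44–L48), Lemma 5.1 (p. 28, L2–L16)] [cite: LiMa2008, Thm. 0.4] -/
theorem odd_natCard_isSquare_classGroup_genusField_two_mul_five_mod_eight {p : ℕ} (hp : p.Prime)
    (hp8 : p % 8 = 5) :
    Odd (Nat.card {a : ClassGroup (𝓞 (GenusField (2 * p))) // IsSquare a}) := by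
  have hd1 : 1 ≤ 2 * p := by have := hp.two_le; omega
  have hq : ∀ i, ((![p] : Fin 1 → ℕ) i).Prime := by intro i; fin_cases i; exact hp
  have hinj : Function.Injective (![p] : Fin 1 → ℕ) := fun i j _ => Subsingleton.elim i j
  have h50 : (![p] : Fin 1 → ℕ) 0 % 8 = 5 := hp8
  have h1 : ∀ i : Fin 1, i ≠ 0 → (![p] : Fin 1 → ℕ) i % 8 = 1 := fun i hi =>
    absurd (Subsingleton.elim i 0) hi
  have hG : ∀ v : Fin 1 → ZMod 2, legendreMatrix ![p] *ᵥ v = 0 → v = 0 ∨ v = fun _ => 1 := by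
    intro v _
    have hv : v = fun _ => v 0 := by funext i; rw [Subsingleton.elim i 0]
    rcases (by decide : ∀ a : ZMod 2, a = 0 ∨ a = 1) (v 0) with h | h
    · left; rw [hv, h]; rfl
    · right; rw [hv, h]
  have hn : ∏ i, (![p] : Fin 1 → ℕ) i = p := by simp
  have hK : IsQuadraticFieldOfSqrt (GenusField (2 * p)) (-(2 * p : ℤ)) := by
    have h := isQuadraticFieldOfSqrt_genusField (d := 2 * p) hd1
    have hc : (-((2 * p : ℕ) : ℤ)) = -(2 * p : ℤ) := by push_cast; ring
    rwa [hc] at h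
  have hc11 := condition11_caseFive ![p] redeiReichardt_fourTwoCard_classGroup_holds hq hinj h50 h1 hG hn
    (GenusField (2 * p)) hK
  unfold Condition11 at hc11
  rw [if_pos (Or.inr hp8)] at hc11
  exact (odd_card_isSquare_iff_fourTwoCard_eq_one _).mpr hc11

/-- **`#𝒜 = 2·#(2𝒜)` for `K = ℚ(√−2p)`, `p ≡ 5 (mod 8)` prime** (`#𝒜 = #(2𝒜)·#𝒜[2]`, `#𝒜[2] = 2`).
[cite: Tian2014, Lemma 5.1 proof (p. 28, L13–L16)] [cite: Cox2013, Prop. 3.11] -/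
theorem natCard_classGroup_genusField_two_mul_five_mod_eight {p : ℕ} (hp : p.Prime) (hp8 : p % 8 = 5) :
    Nat.card (ClassGroup (𝓞 (GenusField (2 * p)))) =
      2 * Nat.card {a : ClassGroup (𝓞 (GenusField (2 * p))) // IsSquare a} := by
  rw [natCard_eq_card_isSquare_mul_card_sq_eq_one (ClassGroup (𝓞 (GenusField (2 * p)))),
    natCard_sq_eq_one_classGroup_genusField_two_mul_five_mod_eight hp hp8, mul_comm]

/-! ## §3 The trace point `y₀ = Σ_{t ∈ 2𝒜} z_t` under `σ_s` and complex conjugation -/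

namespace CMPointDataOne

variable {n : ℕ}

/-- **Derivability of the generation sentence** (a remark for the display audit): "`Gal(H/ℚ)` is generated by `{σ_t}` and
complex conjugation" follows from the two standard sentences "`Gal(H/K) = {σ_t : t ∈ 𝒜}`" (the Artin isomorphism of the
Hilbert class field, Thm. 2.4 (1); `σ` fixing `√−2n` is some `σ_t`) and "complex conjugation moves `√−2n` and is an
involution" — an automorphism moving `√−2n` is `conj ∘ σ_t`. So the generation clause of `galoisFacts` may be traded for
these if a display audit prefers them. [cite: Tian2014, Thm. 2.4 (1) (p0008 L70–L72), Prop. 2.6 (2) (p0009 L18–L20)] [folklore] -/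
theorem mem_closure_of_forall_fix_mem_range (D : CMPointDataOne n)
    (hA : ∀ σ : D.H ≃ₐ[ℚ] D.H, σ D.sqrtNegTwoN = D.sqrtNegTwoN → σ ∈ Set.range D.art)
    (hB : D.conj D.sqrtNegTwoN = -D.sqrtNegTwoN) (hc : D.conj * D.conj = 1) (σ : D.H ≃ₐ[ℚ] D.H) :
    σ ∈ Subgroup.closure (Set.range D.art ∪ {D.conj}) := by
  have hθ2 : D.sqrtNegTwoN ^ 2 = algebraMap ℚ D.H (-((2 * n : ℕ) : ℚ)) := by
    rw [D.sqrtNegTwoN_sq, map_neg, map_natCast]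
  rcases gal_sqrt_eq_or_eq_neg (2 * n) D.sqrtNegTwoN hθ2 σ with h | h
  · exact Subgroup.subset_closure (Or.inl (hA σ h))
  · have h' : (D.conj * σ) D.sqrtNegTwoN = D.sqrtNegTwoN := by
      rw [AlgEquiv.mul_apply, h, map_neg, hB, neg_neg]
    have hmem : D.conj * σ ∈ Subgroup.closure (Set.range D.art ∪ {D.conj}) :=
      Subgroup.subset_closure (Or.inl (hA _ h'))
    have hconj : D.conj ∈ Subgroup.closure (Set.range D.art ∪ {D.conj}) :=
      Subgroup.subset_closure (Or.inr rfl)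
    have : σ = D.conj * (D.conj * σ) := by rw [← mul_assoc, hc, one_mul]
    rw [this]
    exact Subgroup.mul_mem _ hconj hmem

/-- `σ_s` fixes `y₀` for `s ∈ 2𝒜` (`σ_s` permutes the summands: `2𝒜` is a subgroup). [cite: Tian2014, Prop. 4.2 proof (p0020 L5–L9)] -/
theorem act_art_yZero_of_isSquare (D : CMPointDataOne n) (h23 : D.def23)
    {s : ClassGroup (𝓞 (GenusField (2 * n)))} (hs : IsSquare s) : D.act (D.art s) D.yZero = D.yZero := by
  unfold yZero
  rw [map_sum, Finset.sum_congr rfl (fun t _ => h23 s t)]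
  conv_rhs => rw [← image_mul_filter_isSquare_of_isSquare hs]
  rw [Finset.sum_image (fun a _ b _ hab => mul_left_cancel hab)]

/-- **Complex conjugation fixes `y₀`** ("`Gal(H/K(√p₀))` is stable under [inversion] … `y_{p₀}` is fixed by the
action of complex conjugation"): Thm. 2.4 (2) sends `z_t` to `z_{t⁻¹}` and `2𝒜` is inverse-stable.
[cite: Tian2014, Prop. 4.2 proof (p0020 L5–L9), Thm. 2.4 (2) (p0008 L73)] -/
theorem act_conj_yZero (D : CMPointDataOne n) (h2 : D.thm24_2) : D.act D.conj D.yZero = D.yZero := by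
  unfold yZero
  rw [map_sum, Finset.sum_congr rfl (fun t _ => h2 t)]
  conv_rhs => rw [← image_inv_filter_isSquare]
  rw [Finset.sum_image (fun a _ b _ hab => inv_injective hab)]

/-- **`σ_s(y₀) = (0, 0) − y₀` for `s ∉ 2𝒜`** ("`y_{p₀} + y_{p₀}^{σ_ϖ} = #2𝒜·(0, 0) = (0, 0)`"): `s·2𝒜 = [ϖ]·2𝒜`,
Thm. 2.4 (3) (`n ≡ 5 (mod 8)`) and `#(2𝒜)` odd. [cite: Tian2014, Prop. 4.2 proof (p0020 L10–L12), Thm. 2.4 (3) (p0008 L74)] -/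
theorem act_art_yZero_of_not_isSquare (D : CMPointDataOne n) (hn8 : n % 8 = 5) (h3 : D.thm24_3) (h23 : D.def23)
    (hcard : Nat.card (ClassGroup (𝓞 (GenusField (2 * n)))) =
      2 * Nat.card {a : ClassGroup (𝓞 (GenusField (2 * n))) // IsSquare a})
    (hodd : Odd (Nat.card {a : ClassGroup (𝓞 (GenusField (2 * n))) // IsSquare a}))
    (hπ : ¬ IsSquare D.piClass) {s : ClassGroup (𝓞 (GenusField (2 * n)))} (hs : ¬ IsSquare s) :
    D.act (D.art s) D.yZero = ptZero - D.yZero := by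
  have h3' : ∀ t, D.z (D.piClass * t) = ptZero - D.z t := by
    intro t
    have := h3 t
    rw [if_pos hn8] at this
    rw [← this]; abel
  unfold yZero
  rw [map_sum, Finset.sum_congr rfl (fun t _ => h23 s t),
    ← Finset.sum_image (f := D.z) (g := fun t => s * t) (fun a _ b _ hab => mul_left_cancel hab),
    image_mul_filter_isSquare_eq_of_not_isSquare hcard hπ hs,
    Finset.sum_image (f := D.z) (g := fun t => D.piClass * t) (fun a _ b _ hab => mul_left_cancel hab),
    Finset.sum_congr rfl (fun t _ => h3' t), Finset.sum_sub_distrib, Finset.sum_const, card_filter_isSquare,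
    CMPointData.odd_nsmul_of_two_nsmul_eq_zero two_nsmul_ptZero hodd]

/-! ## §4 `2y₀` is the transfer along `√p₀` of a rational point of `E_{p₀}` ("`2y_{p₀} ∈ E(ℚ(√p₀))⁻`") -/

/-- **`2y₀ ∈ E(ℚ(√n))⁻`, on the data**: `2y₀` is fixed by every `σ_s` with `s ∈ 2𝒜` and by complex conjugation, and
negated by every `σ_s` with `s ∉ 2𝒜`; the automorphisms `g` with (`g√n = √n` and `g(2y₀) = 2y₀`) or (`g√n = −√n` and
`g(2y₀) = −2y₀`) form a subgroup containing the generators `{σ_t}` and complex conjugation, hence all of `Gal(H/ℚ)`;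
Galois descent gives a rational point `y′ ∈ E_n(ℚ)` with `transfer y′ = 2y₀`. Inputs: Thm. 2.4 (2)–(3), Def. 2.3, the
generation sentence, "`σ_s√p₀ = √p₀ ⟺ s ∈ 2𝒜`", "complex conjugation fixes `√p₀`", `#𝒜 = 2·#(2𝒜)` odd.
[cite: Tian2014, Prop. 4.2 proof (p0020 L2–L18), Thm. 2.4 (p0008 L68–L74)] [cite: Monsky1990MockHeegner, Thm. 3.5 (p. 53)] -/
theorem exists_transferPos_eq_two_nsmul_yZero (D : CMPointDataOne n) (hn : n ≠ 0) (hn8 : n % 8 = 5)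
    (hP : D.Printed) {θ : D.H} (hθ : θ ^ 2 = (n : D.H)) (hconjθ : D.conj θ = θ)
    (hartθ : ∀ s, D.art s θ = θ ↔ IsSquare s)
    (hcard : Nat.card (ClassGroup (𝓞 (GenusField (2 * n)))) =
      2 * Nat.card {a : ClassGroup (𝓞 (GenusField (2 * n))) // IsSquare a})
    (hodd : Odd (Nat.card {a : ClassGroup (𝓞 (GenusField (2 * n))) // IsSquare a})) :
    ∃ y' : (congruentNumberCurve n).toAffine.Point, D.transferPos hn hθ y' = (2 : ℕ) • D.yZero := by
  obtain ⟨h2, h3, h23, hgen, hπ2, hπ1⟩ := hP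
  have hθ0 : θ ≠ 0 := D.ne_zero_of_sq_eq_natCast hn hθ
  have hθ2 : θ ^ 2 = algebraMap ℚ D.H (n : ℚ) := D.sq_eq_algebraMap_of_sq_eq_natCast hθ
  have hπ : ¬ IsSquare D.piClass := not_isSquare_of_mul_self_eq_one_of_odd hπ2 hπ1 hodd
  set P : EPoint D.H := (2 : ℕ) • D.yZero with hPdef
  -- the generators: `σ_s` and complex conjugation
  have hσ : ∀ s, (D.art s θ = θ ∧ D.act (D.art s) P = P) ∨ (D.art s θ = -θ ∧ D.act (D.art s) P = -P) := by
    intro s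
    by_cases hs : IsSquare s
    · left
      refine ⟨(hartθ s).mpr hs, ?_⟩
      rw [hPdef, map_nsmul, D.act_art_yZero_of_isSquare h23 hs]
    · right
      have hne : D.art s θ ≠ θ := fun h => hs ((hartθ s).mp h)
      refine ⟨(gal_sqrt_pos_eq_or_eq_neg n θ hθ2 (D.art s)).resolve_left hne, ?_⟩
      rw [hPdef, map_nsmul, D.act_art_yZero_of_not_isSquare hn8 h3 h23 hcard hodd hπ hs, smul_sub,
        two_nsmul_ptZero, zero_sub]
  have hconj : D.conj θ = θ ∧ D.act D.conj P = P :=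
    ⟨hconjθ, by rw [hPdef, map_nsmul, D.act_conj_yZero h2]⟩
  -- the subgroup of automorphisms acting on `(θ, P)` by a common sign
  let S : Subgroup (D.H ≃ₐ[ℚ] D.H) :=
    { carrier := {g | (g θ = θ ∧ D.act g P = P) ∨ (g θ = -θ ∧ D.act g P = -P)}
      one_mem' := Or.inl ⟨rfl, D.act_one P⟩
      mul_mem' := by
        intro g h hg hh
        simp only [Set.mem_setOf_eq] at hg hh ⊢
        rw [AlgEquiv.mul_apply, D.act_mul]
        rcases hg with ⟨hgθ, hgP⟩ | ⟨hgθ, hgP⟩ <;> rcases hh with ⟨hhθ, hhP⟩ | ⟨hhθ, hhP⟩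
        · exact Or.inl ⟨by rw [hhθ, hgθ], by rw [hhP, hgP]⟩
        · exact Or.inr ⟨by rw [hhθ, map_neg, hgθ], by rw [hhP, map_neg, hgP]⟩
        · exact Or.inr ⟨by rw [hhθ, hgθ], by rw [hhP, hgP]⟩
        · exact Or.inl ⟨by rw [hhθ, map_neg, hgθ, neg_neg], by rw [hhP, map_neg, hgP, neg_neg]⟩
      inv_mem' := by
        intro g hg
        simp only [Set.mem_setOf_eq] at hg ⊢
        have hinvact : ∀ Q, D.act g⁻¹ (D.act g Q) = Q := fun Q => by
          rw [← D.act_mul, inv_mul_cancel, D.act_one]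
        have hinvθ : ∀ x, g⁻¹ (g x) = x := fun x => by
          rw [← AlgEquiv.mul_apply, inv_mul_cancel, AlgEquiv.one_apply]
        rcases hg with ⟨hgθ, hgP⟩ | ⟨hgθ, hgP⟩
        · left
          refine ⟨?_, ?_⟩
          · conv_lhs => rw [← hgθ]
            exact hinvθ θ
          · conv_lhs => rw [← hgP]
            exact hinvact P
        · right
          refine ⟨?_, ?_⟩
          · have := hinvθ θ
            rw [hgθ, map_neg] at this
            exact neg_eq_iff_eq_neg.mp this
          · have := hinvact P
            rw [hgP, map_neg] at this
            exact neg_eq_iff_eq_neg.mp this }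
  have hall : ∀ g : D.H ≃ₐ[ℚ] D.H, g ∈ S := by
    intro g
    have hle : Subgroup.closure (Set.range D.art ∪ {D.conj}) ≤ S := by
      rw [Subgroup.closure_le]
      rintro σ (⟨s, rfl⟩ | hσ)
      · exact hσ s
      · rw [Set.mem_singleton_iff] at hσ
        rw [hσ]; exact Or.inl hconj
    exact hle (hgen g)
  have hθne : θ ≠ -θ := by
    intro h
    apply hθ0
    have : (2 : D.H) * θ = 0 := by linear_combination h
    rcases mul_eq_zero.mp this with h2 | h2
    · exact absurd h2 two_ne_zero
    · exact h2
  have hfix : ∀ g : D.H ≃ₐ[ℚ] D.H, g θ = θ →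
      WeierstrassCurve.Affine.Point.map (W' := congruentNumberCurve 1) g.toAlgHom P = P := by
    intro g hg
    rcases hall g with ⟨-, h⟩ | ⟨hg', -⟩
    · exact h
    · exact absurd (hg.symm.trans hg') hθne
  have hneg : ∀ g : D.H ≃ₐ[ℚ] D.H, g θ = -θ →
      WeierstrassCurve.Affine.Point.map (W' := congruentNumberCurve 1) g.toAlgHom P = -P := by
    intro g hg
    rcases hall g with ⟨hg', -⟩ | ⟨-, h⟩
    · exact absurd (hg'.symm.trans hg) hθne
    · exact h
  exact exists_transferEPos_eq_of_forall_gal n θ hθ2 hθ0 P hfix hneg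

/-- **`y₀ ∉ E(ℚ(√n))⁻`** (the first claim of Prop. 4.2, "`y_{p₀} ∈ E(ℚ(√p₀)) ∖ E(ℚ(√p₀))⁻`"): `y₀` itself is NOT the
transfer of a rational point of `E_n` — `σ_{[ϖ]}` would negate it, but `σ_{[ϖ]}(y₀) = (0, 0) − y₀` and `(0, 0) ≠ 0`.
[cite: Tian2014, Prop. 4.2 (p0019 L74–L81) and its proof (p0020 L10–L15)] [cite: Monsky1990MockHeegner, Thm. 3.5 (p. 53: "2S_N ∈ Λ_N")] -/
theorem not_exists_transferPos_eq_yZero (D : CMPointDataOne n) (hn : n ≠ 0) (hn8 : n % 8 = 5) (hP : D.Printed)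
    {θ : D.H} (hθ : θ ^ 2 = (n : D.H)) (hartθ : ∀ s, D.art s θ = θ ↔ IsSquare s)
    (hcard : Nat.card (ClassGroup (𝓞 (GenusField (2 * n)))) =
      2 * Nat.card {a : ClassGroup (𝓞 (GenusField (2 * n))) // IsSquare a})
    (hodd : Odd (Nat.card {a : ClassGroup (𝓞 (GenusField (2 * n))) // IsSquare a})) :
    ¬ ∃ w : (congruentNumberCurve n).toAffine.Point, D.transferPos hn hθ w = D.yZero := by
  rintro ⟨w, hw⟩
  obtain ⟨-, h3, h23, -, hπ2, hπ1⟩ := hP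
  have hθ0 : θ ≠ 0 := D.ne_zero_of_sq_eq_natCast hn hθ
  have hθ2 : θ ^ 2 = algebraMap ℚ D.H (n : ℚ) := D.sq_eq_algebraMap_of_sq_eq_natCast hθ
  have hπ : ¬ IsSquare D.piClass := not_isSquare_of_mul_self_eq_one_of_odd hπ2 hπ1 hodd
  have hπθ : D.art D.piClass θ = -θ :=
    (gal_sqrt_pos_eq_or_eq_neg n θ hθ2 (D.art D.piClass)).resolve_left (fun h => hπ ((hartθ _).mp h))
  have h1 : D.act (D.art D.piClass) D.yZero = -D.yZero := by
    rw [← hw]; exact act_transferEPos_of_neg n θ hθ2 hθ0 _ hπθ w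
  have h2 := D.act_art_yZero_of_not_isSquare hn8 h3 h23 hcard hodd hπ hπ
  rw [h1] at h2
  have : (ptZero : EPoint D.H) = 0 := by
    calc (ptZero : EPoint D.H) = (ptZero - D.yZero) + D.yZero := by abel
      _ = -D.yZero + D.yZero := by rw [← h2]
      _ = 0 := by abel
  exact WeierstrassCurve.Affine.Point.some_ne_zero _ this

/-! ## §5 Tian Prop. 4.2 / Monsky Thm. 3.6 on the data: `2y₀ ∉ 2E(ℚ(√p₀))⁻ + E[2]` -/

/-- **`√2 ∉ H` when `i ∉ H`** (on the data, for `n ≠ 0`): `(√−2n / (√n·√2))² = −1`. [cite: Tian2014, §4.2 (p0022 L52–L56: "√2 ∈ H₀ but i ∉ H")] [folklore] -/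
theorem sq_ne_two_of_sq_ne_neg_one (D : CMPointDataOne n) (hn : n ≠ 0) {θ : D.H} (hθ : θ ^ 2 = (n : D.H))
    (hnoI : ∀ x : D.H, x ^ 2 ≠ -1) (s : D.H) : s ^ 2 ≠ 2 := by
  intro hs
  have hθ0 : θ ≠ 0 := D.ne_zero_of_sq_eq_natCast hn hθ
  have hs0 : s ≠ 0 := by rintro rfl; norm_num at hs
  apply hnoI (D.sqrtNegTwoN / (θ * s))
  rw [div_pow, mul_pow, hs, hθ, D.sqrtNegTwoN_sq]
  have hn' : (n : D.H) ≠ 0 := Nat.cast_ne_zero.mpr hn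
  push_cast
  field_simp

/-- **Tian Prop. 4.2 (= Monsky Thm. 3.6), the descent step, on the data**: for a system `D` with the printed
properties, `n = p₀ ≡ 5 (mod 8)` square-free, a square root `θ = √p₀ ∈ H` fixed by complex conjugation with
"`σ_s√p₀ = √p₀ ⟺ s ∈ 2𝒜`", `#𝒜 = 2·#(2𝒜)` with `#(2𝒜)` odd, and "`i ∉ H`": the rational point `y″ ∈ E_{p₀}(ℚ)`
with `transfer y″ = 2y₀` (§4) is NOT of the form `2z + t` with `t` torsion. If it were, `Q := y₀ − transfer z`
would satisfy `2Q = transfer t ∈ E[2]`, so `4Q = 0`, hence `2Q = 0` (`E(H)[4] = E[2]`, §5 of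
`CMPointSystemOneModFour`), `Q` rational `2`-torsion, and `σ_{[ϖ]}(y₀) = −transfer z + Q = −y₀ + 2Q = −y₀`,
against `σ_{[ϖ]}(y₀) = (0, 0) − y₀` (§3). [cite: Tian2014, Prop. 4.2 proof (p0020 L19–L21)] [cite: Monsky1990MockHeegner, Thm. 3.6 (p. 53)] -/
theorem exists_transferPos_eq_two_nsmul_yZero_not_two_smul_add_torsion (D : CMPointDataOne n) (hn : n ≠ 0)
    (hsq : Squarefree n) (hn8 : n % 8 = 5) (hP : D.Printed) {θ : D.H} (hθ : θ ^ 2 = (n : D.H))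
    (hconjθ : D.conj θ = θ) (hartθ : ∀ s, D.art s θ = θ ↔ IsSquare s) (hnoI : ∀ x : D.H, x ^ 2 ≠ -1)
    (hcard : Nat.card (ClassGroup (𝓞 (GenusField (2 * n)))) =
      2 * Nat.card {a : ClassGroup (𝓞 (GenusField (2 * n))) // IsSquare a})
    (hodd : Odd (Nat.card {a : ClassGroup (𝓞 (GenusField (2 * n))) // IsSquare a})) :
    ∃ y' : (congruentNumberCurve n).toAffine.Point, D.transferPos hn hθ y' = (2 : ℕ) • D.yZero ∧
      ∀ z t : (congruentNumberCurve n).toAffine.Point, IsOfFinAddOrder t → y' ≠ (2 : ℤ) • z + t := by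
  obtain ⟨y', hy'⟩ := D.exists_transferPos_eq_two_nsmul_yZero hn hn8 hP hθ hconjθ hartθ hcard hodd
  refine ⟨y', hy', ?_⟩
  intro z t ht heq
  obtain ⟨-, h3, h23, -, hπ2, hπ1⟩ := hP
  have hθ0 : θ ≠ 0 := D.ne_zero_of_sq_eq_natCast hn hθ
  have hθ2 : θ ^ 2 = algebraMap ℚ D.H (n : ℚ) := D.sq_eq_algebraMap_of_sq_eq_natCast hθ
  have hπ : ¬ IsSquare D.piClass := not_isSquare_of_mul_self_eq_one_of_odd hπ2 hπ1 hodd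
  have ht2 : (2 : ℕ) • t = 0 := two_nsmul_eq_zero_of_isOfFinAddOrder_congruentNumberCurve hsq ht
  set S : EPoint D.H := D.transferPos hn hθ z with hS
  set T : EPoint D.H := D.transferPos hn hθ t with hT
  have hyST : (2 : ℕ) • D.yZero = (2 : ℕ) • S + T := by
    rw [← hy', heq, map_add, map_zsmul, two_zsmul, two_nsmul]
  have hT2 : (2 : ℕ) • T = 0 := by rw [hT, ← map_nsmul, ht2, map_zero]
  set Q : EPoint D.H := D.yZero - S with hQdef
  have h2Q : (2 : ℕ) • Q = T := by rw [hQdef, smul_sub, hyST]; abel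
  have h4Q : (2 : ℕ) • ((2 : ℕ) • Q) = 0 := by rw [h2Q, hT2]
  -- `E(H)[4] = E[2]`: `Q` is rational `2`-torsion
  have h2Q0 : (2 : ℕ) • Q = 0 :=
    two_nsmul_eq_zero_of_two_nsmul_two_nsmul_eq_zero_of_no_sqrt hnoI (D.sq_ne_two_of_sq_ne_neg_one hn hθ hnoI)
      Q h4Q
  -- `σ_{[ϖ]}` negates the transfer image and fixes `Q`
  have hπθ : D.art D.piClass θ = -θ :=
    (gal_sqrt_pos_eq_or_eq_neg n θ hθ2 (D.art D.piClass)).resolve_left (fun h => hπ ((hartθ _).mp h))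
  have hSπ : D.act (D.art D.piClass) S = -S := by
    rw [hS]; exact act_transferEPos_of_neg n θ hθ2 hθ0 _ hπθ z
  have hQπ : D.act (D.art D.piClass) Q = Q := by
    have := map_sub_self_eq_zero_of_two_nsmul_eq_zero (D.art D.piClass) Q h2Q0
    rw [sub_eq_zero] at this
    exact this
  -- `σ_{[ϖ]}(y₀) = (0,0) − y₀` against `σ_{[ϖ]}(y₀) = −S + Q = −y₀ + 2Q = −y₀`
  have hyπ := D.act_art_yZero_of_not_isSquare hn8 h3 h23 hcard hodd hπ hπ
  have hy0 : D.yZero = S + Q := by rw [hQdef]; abel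
  rw [hy0, map_add, hSπ, hQπ] at hyπ
  have hcontra : (ptZero : EPoint D.H) = (2 : ℕ) • Q := by
    have := hyπ
    rw [two_nsmul]
    -- `−S + Q = (0,0) − (S + Q)` ⟹ `(0,0) = Q + Q`
    calc (ptZero : EPoint D.H) = (ptZero - (S + Q)) + (S + Q) := by abel
      _ = (-S + Q) + (S + Q) := by rw [this]
      _ = Q + Q := by abel
  rw [h2Q0] at hcontra
  exact WeierstrassCurve.Affine.Point.some_ne_zero _ hcontra

/-- **Tian Prop. 4.2 / Monsky Thm. 3.6 for `n = p₀ ≡ 5 (mod 8)` prime, on the data**: from the printed system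
`D.Printed`, the two printed §4.1 sentences on `√p₀ ∈ H` ("complex conjugation fixes the real `√p₀`";
"`2𝒜 ≅ Gal(H/K(√p₀))`") and "`i ∉ H`", taken as BINDERS, the rational point `y″ ∈ E_{p₀}(ℚ)` with
`transfer y″ = 2y_{p₀}` lies outside `2E_{p₀}(ℚ) + E_{p₀}(ℚ)_tor` — in particular it is of infinite order,
`rank E_{p₀}(ℚ) ≥ 1` and `p₀` is a congruent number (Cor. 5.15 (1) «`p₅`», for Tian's point). "`#(2𝒜)` odd",
"`#𝒜[2] = 2`" and the `2`-torsion of `E_{p₀}(ℚ)` are tree theorems.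
[cite: Tian2014, Prop. 4.2 (p0019 L74–L81) and its proof (p0020 L2–L23)] [cite: Monsky1990MockHeegner, Thm. 3.6 (p. 53), Cor. 5.15 (1) (p. 66)] -/
theorem exists_transferPos_eq_two_nsmul_yZero_not_two_smul_add_torsion_prime_five_mod_eight
    (D : CMPointDataOne n) (hn : n.Prime) (hn8 : n % 8 = 5) (hP : D.Printed) {θ : D.H}
    (hθ : θ ^ 2 = (n : D.H)) (hconjθ : D.conj θ = θ) (hartθ : ∀ s, D.art s θ = θ ↔ IsSquare s)
    (hnoI : ∀ x : D.H, x ^ 2 ≠ -1) :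
    ∃ y' : (congruentNumberCurve n).toAffine.Point, D.transferPos hn.ne_zero hθ y' = (2 : ℕ) • D.yZero ∧
      ∀ z t : (congruentNumberCurve n).toAffine.Point, IsOfFinAddOrder t → y' ≠ (2 : ℤ) • z + t :=
  D.exists_transferPos_eq_two_nsmul_yZero_not_two_smul_add_torsion hn.ne_zero hn.prime.squarefree hn8 hP hθ
    hconjθ hartθ hnoI (natCard_classGroup_genusField_two_mul_five_mod_eight hn hn8)
    (odd_natCard_isSquare_classGroup_genusField_two_mul_five_mod_eight hn hn8)

/-- **Prop. 4.2, first claim, for `n = p₀ ≡ 5 (mod 8)` prime**: `y_{p₀} ∉ E(ℚ(√p₀))⁻` — the trace point itself is not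
the transfer of a rational point of `E_{p₀}` (only `2y_{p₀}` is). [cite: Tian2014, Prop. 4.2 (p0019 L74–L81)] -/
theorem not_exists_transferPos_eq_yZero_prime_five_mod_eight (D : CMPointDataOne n) (hn : n.Prime)
    (hn8 : n % 8 = 5) (hP : D.Printed) {θ : D.H} (hθ : θ ^ 2 = (n : D.H))
    (hartθ : ∀ s, D.art s θ = θ ↔ IsSquare s) :
    ¬ ∃ w : (congruentNumberCurve n).toAffine.Point, D.transferPos hn.ne_zero hθ w = D.yZero :=
  D.not_exists_transferPos_eq_yZero hn.ne_zero hn8 hP hθ hartθ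
    (natCard_classGroup_genusField_two_mul_five_mod_eight hn hn8)
    (odd_natCard_isSquare_classGroup_genusField_two_mul_five_mod_eight hn hn8)

end CMPointDataOne

end Literature.NumberTheory.EllipticCurves.Tian2014

end
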